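/-
Copyright (c) 2026 the pub-hodgecm-mathlib formalisation cell (harness21).  Prover seat hodgecm-mathlib-K2E1-p02 (g5), Track B ∕ K2-LIT,
h413 = `stmt-HodgeConjecture-24833`, line `K2_E1_TraceFormulaBeta`, campaign RES-RANK-ONE, brick F3-c + (H2)-f: the cuspidality criterion of ★ F3a∕F3b cut on the
SQUARE-INTEGRABLE test class, and the unconditional density `(L²_cusp)ᗮ = closure (span {[θ_Φ]})`.  2026-09-04.
-/
import Summits.HodgeConjecture.HodgeConjecture.Theorems.K2E1PseudoEisensteinCuspidalCriterion   -- ★ p857006 (F3a, K2E1-p09 (g3)): §1 `continuous_constantTerm`, bounds, invariance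
import Summits.HodgeConjecture.HodgeConjecture.Theorems.K2E1PseudoEisensteinBounded              -- ★ (H2)-e (K2E1-p02 (g5)): `lintegral_tsum_enorm_sq_lt_top`, `enorm_indicator_comp_mk_le`
import Summits.HodgeConjecture.HodgeConjecture.Theorems.K2E1PseudoEisensteinDensity              -- ★ p857049 ((H2)-d, K2E1-p02 (g5)): density under `hF3`
import Mathlib.MeasureTheory.Measure.Haar.Unique
import HarnessLib

/-!
# h413 ∕ Track B «K2-LIT», campaign RES-RANK-ONE, bricks F3-c and (H2)-f — helper `K2E1PseudoEisensteinCuspidalCriterionL2`: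
# `ψ` continuous and `⟨θ_Φ, ψ⟩ = 0` for all SQUARE-INTEGRABLE pseudo-Eisenstein series ⟹ the constant term of `ψ` vanishes; hence `(L²_cusp)ᗮ = closure (span Θ)`

Cell `pub/hodgecm-mathlib`, crux H413 = `stmt-HodgeConjecture-24833`, route `HCCMUnconditional`; chair K2-lead (g0), dealer K2E1-plan (g2), JUNCTION RULING
2026-09-04T03:16:58Z ∕ refinement 03:23:58Z.  THEOREMS ONLY (no `def`, no `instance`, no `notation`, no named-fact hypothesis, no `sorry`); lane
`--kind proof --supports stmt-HodgeConjecture-24833 --as helper` (count-neutral).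

★ F3a `setIntegral_constantTerm_eq_zero_of_forall_pseudoEisenstein` (K2E1-p09 (g3)) assumes `∫ θ_Φ · conj ψ dμ = 0` for every Borel right-`N`-invariant `Φ` on the
«finite pairing» domain `∫⁻ θ_{‖Φ‖}‖ψ‖ dμ < ∞`; the density theorem ★ (H2)-d `K2E1PseudoEisensteinDensity` needs the criterion on the SQUARE-INTEGRABLE test class
`𝒯 = {Φ : ∫⁻ θ_{‖Φ‖}² dμ < ∞}` (hypothesis `hF3` there), the only class stable under the regular representation.  F3a's proof tests only `Φ = 𝟙_S ∘ π_N` with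
`S ⊆ π_N(K₀)` Borel, `K₀` compact — and these lie in `𝒯` by the lattice-point count ★ (H2)-e `K2E1PseudoEisensteinBounded` (`θ_{𝟙_{K₀N}} ≤ #(Γ ∩ CK₀⁻¹K₀C⁻¹)`, `μ` finite).
So:

* §1 **`setIntegral_constantTerm_eq_zero_of_forall_sq`** = ★ F3a §2 VERBATIM with the hypothesis `horth` restricted to `𝒯` (and `μ` finite): the proof is F3a's
  (★ F3a §1 `continuous_constantTerm`, `exists_bound_norm_apply_mk`, `setIntegral_constantTerm_mul_coe_eq`, `setLIntegral_constantTerm_mul_coe_eq` by import; ★ F1∕F2a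
  unfolding∕adjunction; Mathlib `Integrable.ae_eq_zero_of_forall_setIntegral_eq_zero`), the single new line being ★ (H2)-e for the test function.
* §2 **`constantTermVanishes_of_forall_pseudoEisenstein_sq`** = ★ F3b VERBATIM on `𝒯_i`: on `X = G(𝔸) ⧸ G(K)` (`A_G = 1`, `μ` automorphic, `N_i(K)` co-compact, `ν_N`
  inversion-invariant Haar, `μ_N` invariant and positive on opens) a CONTINUOUS `ψ` with `∫ θ_Φ · conj ψ dμ = 0` for all `Φ ∈ 𝒯_i` has ★ `ConstantTermVanishes 𝔓 ψ i`
  — this IS the hypothesis `hF3` of ★ (H2)-d at the radical `N_i`, byte for byte.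
* §3 (H2)-f ASSEMBLY: `hF3` DISCHARGED — **`orthogonal_span_pseudoEisenstein_le_cuspidalSubspace_of_cocompact`** (`(span Θ)ᗮ ≤ L²_cusp`) and the HEADLINE
  **`cuspidalSubspace_orthogonal_eq_topologicalClosure_span_of_cocompact`: `(L²_cusp)ᗮ = closure (span Θ)`**, `Θ = {[θ_Φ] : i, Φ ∈ 𝒯_i}`, under EXACTLY ★ F3b's
  hypotheses at every radical (`hQ`; `N_i(𝔸)` closed; `N_i(K)` co-compact; `μ_N` invariant, finite on compacts, positive on opens; `ν_N` Haar, s-finite,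
  inversion-invariant, with a measurable fundamental domain for `N_i(K)`) — no reduction theory, no group-specific input.
  [MoeglinWaldspurger1995 II.1: «the orthogonal of the pseudo-Eisenstein series of all proper parabolics is the space of cusp forms»; Garrett §1.8–1.9.]

HONEST LABEL.  Count-neutral helper; proves no printed statement; HC_CM is proved only modulo the 7 printed citations (2 remaining named inputs: hLiu418 =
`stmt-HodgeConjecture-24832`, h413 = `stmt-HodgeConjecture-24833`) until rung 0 closes.

## References
* [MoeglinWaldspurger1995] C. Mœglin, J.-L. Waldspurger, *Spectral decomposition and Eisenstein series* (1995), II.1.1–II.1.4, I.2.6 ·  [Garrett2018] P. Garrett,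
  *Modern Analysis of Automorphic Forms by Example* 1 (2018), §1.8–1.9 · [BorelJacquet1979] A. Borel, H. Jacquet, PSPM 33.1 (1979), §4.4–4.6.
-/

set_option autoImplicit false
set_option linter.dupNamespace false  -- the mandated namespace repeats the summit's segment (`HodgeConjecture.HodgeConjecture`)

noncomputable section

open MeasureTheory Measure Set Filter Topology
open Literature.MeasureTheory.Group Literature.NumberTheory.Automorphic
open Summit.HodgeConjecture.HodgeConjecture.Cruxes.H413.K2E1PseudoEisensteinUnfolding
open Summit.HodgeConjecture.HodgeConjecture.Cruxes.H413.K2E1PseudoEisensteinAdjunction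
open Summit.HodgeConjecture.HodgeConjecture.Cruxes.H413.K2E1PseudoEisensteinCuspOrthogonal
open Summit.HodgeConjecture.HodgeConjecture.Cruxes.H413.K2E1PseudoEisensteinCuspidalCriterion
open Summit.HodgeConjecture.HodgeConjecture.Cruxes.H413.K2E1PseudoEisensteinBounded
open Summit.HodgeConjecture.HodgeConjecture.Cruxes.H413.K2E1PseudoEisensteinDensity
open scoped ENNReal NNReal Pointwise ComplexConjugate InnerProductSpace

namespace Summit.HodgeConjecture.HodgeConjecture.Cruxes.H413.K2E1PseudoEisensteinCuspidalCriterionL2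

/-! ## §1 The criterion on the square-integrable test class (generic coset-space form) -/

section Criterion

variable {G : Type*} [Group G] [TopologicalSpace G] [IsTopologicalGroup G] [LocallyCompactSpace G] [SecondCountableTopology G] [T2Space G]
  [MeasurableSpace G] [BorelSpace G] (Γ N : Subgroup G) [DiscreteTopology Γ] [hN : IsClosed (N : Set G)]
  [MeasurableSpace (G ⧸ Γ)] [BorelSpace (G ⧸ Γ)] [MeasurableSpace (G ⧸ N)] [BorelSpace (G ⧸ N)]
  (μ : Measure (G ⧸ Γ)) [SMulInvariantMeasure G (G ⧸ Γ) μ] [IsFiniteMeasure μ]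
  (μN : Measure (G ⧸ N)) [SMulInvariantMeasure G (G ⧸ N) μN] [IsFiniteMeasureOnCompacts μN] [μN.IsOpenPosMeasure]
  (ν : Measure G) [IsHaarMeasure ν] (νN : Measure N) [IsHaarMeasure νN] [SFinite νN] [νN.IsInvInvariant]

include μN ν in
/-- **THE CUSPIDALITY CRITERION ALONG `N`, SQUARE-INTEGRABLE TEST CLASS.**  `Γ ≤ G` discrete, `N ≤ G` closed unimodular with `Γ ∩ N` CO-COMPACT in `N`, `μ ≠ 0` a FINITE
invariant measure on `G ⧸ Γ`, `μ_N` invariant on `G ⧸ N` and positive on non-empty open sets, `ν`, `ν_N` Haar.  If `ψ : G ⧸ Γ → ℂ` is CONTINUOUS and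
`∫_{G⧸Γ} θ_Φ · conj ψ dμ = 0` for every Borel right-`N`-invariant `Φ : G → ℂ` with `∫⁻_{G⧸Γ} θ_{‖Φ‖}² dμ < ∞`, then `∫_𝓕 ψ((g u⁻¹)Γ) dν_N(u) = 0` for every measurable
fundamental domain `𝓕` of `Γ ∩ N` and every `g`.  Proof = ★ F3a's, whose tests `𝟙_S ∘ π_N` (`S ⊆ π_N(K₀)` Borel) are square-integrable by ★ (H2)-e.
[cite: MoeglinWaldspurger1995, II.1.3] [cite: Garrett2018, §1.8] -/
theorem setIntegral_constantTerm_eq_zero_of_forall_sq (hμ : μ ≠ 0) {ψ : G ⧸ Γ → ℂ} (hψ : Continuous ψ)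
    {C : Set N} (hC : IsCompact C) (hcov : ∀ u : N, ∃ δ : Γ.subgroupOf N, δ • u ∈ C)
    (horth : ∀ Φ : G → ℂ, Measurable Φ → (∀ (g : G) (n : N), Φ (g * n) = Φ g) →
      ∫⁻ x, (∑' q : Γ ⧸ N.subgroupOf Γ, ‖Φ (x.out * (q.out : G))‖ₑ) ^ 2 ∂μ < ∞ →
        ∫ x, (∑' q : Γ ⧸ N.subgroupOf Γ, Φ (x.out * (q.out : G))) * conj (ψ x) ∂μ = 0)
    {𝓕 : Set N} (h𝓕 : IsFundamentalDomain (Γ.subgroupOf N) 𝓕 νN) (g : G) :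
    ∫ u in 𝓕, ψ (QuotientGroup.mk (g * (u : G)⁻¹)) ∂νN = 0 := by
  haveI : IsClosed (Γ : Set G) := Subgroup.isClosed_of_discrete
  have hmkΓ : Measurable (QuotientGroup.mk : G → G ⧸ Γ) := QuotientGroup.continuous_mk.measurable
  have hmkN : Measurable (QuotientGroup.mk : G → G ⧸ N) := QuotientGroup.continuous_mk.measurable
  have hψm : Measurable ψ := hψ.measurable
  have hψc' : Continuous fun x : G ⧸ Γ => conj (ψ x) := Complex.continuous_conj.comp hψ
  have hfin𝓕 : νN 𝓕 < ∞ := (measure_le_of_isFundamentalDomain Γ N νN hcov h𝓕).trans_lt hC.measure_lt_top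
  have hμN0 : μN ≠ 0 := fun h0 => by
    have hpos := isOpen_univ.measure_pos μN ⟨(QuotientGroup.mk 1 : G ⧸ N), trivial⟩
    rw [h0] at hpos
    exact lt_irrefl _ hpos
  -- the constant term of `conj ψ`: continuous on `G`, right-`N`-invariant, hence a continuous function `h̄` on `G ⧸ N`
  obtain ⟨h, hh⟩ : ∃ h : G → ℂ, ∀ x, h x = ∫ u in 𝓕, conj (ψ (QuotientGroup.mk (x * (u : G)⁻¹))) ∂νN := ⟨_, fun _ => rfl⟩
  have hhdef : h = fun x => ∫ u in 𝓕, conj (ψ (QuotientGroup.mk (x * (u : G)⁻¹))) ∂νN := funext hh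
  have hhc : Continuous h := by
    rw [hhdef]
    exact continuous_constantTerm Γ N νN hψc' hC hcov h𝓕
  have hhN : ∀ (x : G) (n : N), h (x * n) = h x := fun x n => by
    rw [hh, hh]
    exact setIntegral_constantTerm_mul_coe_eq Γ N νN hψc' hC hcov h𝓕 x n
  obtain ⟨hb, hhb⟩ : ∃ hb : G ⧸ N → ℂ, ∀ y, hb y = h y.out := ⟨_, fun _ => rfl⟩
  have hcomp : hb ∘ (QuotientGroup.mk : G → G ⧸ N) = h := by
    funext x
    obtain ⟨n, hn⟩ := QuotientGroup.mk_out_eq_mul N x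
    rw [Function.comp_apply, hhb, hn, hhN]
  have hbc : Continuous hb := by
    rw [← QuotientGroup.isOpenQuotientMap_mk.continuous_comp_iff, hcomp]
    exact hhc
  have hbm : Measurable hb := hbc.measurable
  -- it suffices to show `hb = 0` everywhere
  suffices hzero : ∀ y : G ⧸ N, hb y = 0 by
    have h1 : h g = 0 := by rw [← hcomp, Function.comp_apply, hzero]
    rw [hh, integral_conj] at h1
    exact (map_eq_zero_iff _ (RingHom.injective _)).1 h1
  -- bounds on `π_N(K₀)` for a compact `K₀`
  have hbound : ∀ {K₀ : Set G}, IsCompact K₀ → ∃ M : ℝ, 0 ≤ M ∧ (∀ y ∈ QuotientGroup.mk '' K₀, ‖hb y‖ ≤ M * (νN 𝓕).toReal) ∧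
      ∀ y ∈ QuotientGroup.mk '' K₀, ∫⁻ u in 𝓕, ‖ψ (QuotientGroup.mk ((y : G ⧸ N).out * (u : G)⁻¹))‖ₑ ∂νN ≤ ENNReal.ofReal M * νN 𝓕 := by
    intro K₀ hK₀
    obtain ⟨M, hM0, hM⟩ := exists_bound_norm_apply_mk Γ N hψ hC hcov hK₀
    refine ⟨M, hM0, fun y hy => ?_, fun y hy => ?_⟩
    · obtain ⟨k, hk, rfl⟩ := hy
      obtain ⟨n, hn⟩ := QuotientGroup.mk_out_eq_mul N k
      rw [hhb, hn, hhN, hh]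
      calc ‖∫ u in 𝓕, conj (ψ (QuotientGroup.mk (k * (u : G)⁻¹))) ∂νN‖
          ≤ M * νN.real 𝓕 := by
            refine norm_setIntegral_le_of_norm_le_const hfin𝓕 fun u _ => ?_
            rw [Complex.norm_conj]
            exact hM k hk u
        _ = M * (νN 𝓕).toReal := by rw [measureReal_def]
    · obtain ⟨k, hk, rfl⟩ := hy
      obtain ⟨n, hn⟩ := QuotientGroup.mk_out_eq_mul N k
      rw [hn, setLIntegral_constantTerm_mul_coe_eq Γ N νN (Ψ := fun x => ‖ψ x‖ₑ) hψm.enorm h𝓕 k n]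
      calc ∫⁻ u in 𝓕, ‖ψ (QuotientGroup.mk (k * (u : G)⁻¹))‖ₑ ∂νN ≤ ∫⁻ _ in 𝓕, ENNReal.ofReal M ∂νN := by
            refine lintegral_mono fun u => ?_
            rw [← ofReal_norm]
            exact ENNReal.ofReal_le_ofReal (hM k hk u)
        _ = ENNReal.ofReal M * νN 𝓕 := setLIntegral_const _ _
  -- `∫_S hb dμ_N = 0` for Borel `S ⊆ π_N(K₀)`
  have hvanish : ∀ {K₀ : Set G}, IsCompact K₀ → ∀ S : Set (G ⧸ N), MeasurableSet S → S ⊆ QuotientGroup.mk '' K₀ → ∫ y in S, hb y ∂μN = 0 := by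
    intro K₀ hK₀ S hS hSK
    obtain ⟨M, hM0, -, hMl⟩ := hbound hK₀
    have hSfin : μN S < ∞ := (measure_mono hSK).trans_lt (hK₀.image QuotientGroup.continuous_mk).measure_lt_top
    -- the test function `Φ = 𝟙_S ∘ π_N`
    obtain ⟨Φ, hΦ⟩ : ∃ Φ : G → ℂ, ∀ x, Φ x = S.indicator (fun _ => (1 : ℂ)) (QuotientGroup.mk x) := ⟨_, fun _ => rfl⟩
    have hΦdef : Φ = fun x => S.indicator (fun _ => (1 : ℂ)) (QuotientGroup.mk x) := funext hΦ
    have hΦm : Measurable Φ := by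
      rw [hΦdef]
      exact (measurable_const.indicator hS).comp hmkN
    have hΦN : ∀ (x : G) (n : N), Φ (x * n) = Φ x := fun x n => by rw [hΦ, hΦ, QuotientGroup.mk_mul_of_mem x n.2]
    have hΦnorm : ∀ x : G, ‖Φ x‖ₑ = S.indicator (fun _ => (1 : ℝ≥0∞)) (QuotientGroup.mk x) := fun x => by
      rw [hΦ]
      by_cases hx : (QuotientGroup.mk x : G ⧸ N) ∈ S
      · rw [Set.indicator_of_mem hx, Set.indicator_of_mem hx, enorm_one]
      · rw [Set.indicator_of_notMem hx, Set.indicator_of_notMem hx, enorm_zero]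
    -- NEW (★ (H2)-e): the test function is SQUARE-INTEGRABLE — `‖Φ‖ ≤ 𝟙_{K₀N}` and `θ_{𝟙_{K₀N}}` is bounded by a lattice-point count
    have h2Φ : ∫⁻ x, (∑' q : Γ ⧸ N.subgroupOf Γ, ‖Φ (x.out * (q.out : G))‖ₑ) ^ 2 ∂μ < ∞ :=
      lintegral_tsum_enorm_sq_lt_top Γ N μ hC hcov hK₀ fun x => by
        rw [hΦ]
        exact enorm_indicator_comp_mk_le N hSK x
    -- finiteness of the pairing, by ★ F1 and the bound on `π_N(K₀)`
    have hfinΦ : ∫⁻ x, (∑' q : Γ ⧸ N.subgroupOf Γ, ‖Φ (x.out * (q.out : G))‖ₑ) * ‖ψ x‖ₑ ∂μ < ∞ := by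
      have hpos := unfoldingConstant_pos_of_ne_zero Γ N μ μN ν νN hμ hμN0
      have h1 := lintegral_pseudoEisenstein_mul_eq Γ N μ μN ν νN (Φ := fun x => ‖Φ x‖ₑ) hΦm.enorm (fun x n => by rw [hΦN]) hψm.enorm h𝓕
      have h2 : ∫⁻ y, ‖Φ y.out‖ₑ * ∫⁻ u in 𝓕, ‖ψ (QuotientGroup.mk (y.out * (u : G)⁻¹))‖ₑ ∂νN ∂μN ≤ ENNReal.ofReal M * νN 𝓕 * μN S := by
        calc ∫⁻ y, ‖Φ y.out‖ₑ * ∫⁻ u in 𝓕, ‖ψ (QuotientGroup.mk (y.out * (u : G)⁻¹))‖ₑ ∂νN ∂μN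
            ≤ ∫⁻ y, S.indicator (fun _ => ENNReal.ofReal M * νN 𝓕) y ∂μN := by
              refine lintegral_mono fun y => ?_
              rw [hΦnorm, QuotientGroup.out_eq']
              by_cases hy : y ∈ S
              · rw [Set.indicator_of_mem hy, Set.indicator_of_mem hy, one_mul]
                exact hMl y (hSK hy)
              · rw [Set.indicator_of_notMem hy, Set.indicator_of_notMem hy, zero_mul]
          _ = ENNReal.ofReal M * νN 𝓕 * μN S := by rw [lintegral_indicator_const hS]
      have h3 : (unfoldingConstant N νN μN ν : ℝ≥0∞) * ∫⁻ x, (∑' q : Γ ⧸ N.subgroupOf Γ, ‖Φ (x.out * (q.out : G))‖ₑ) * ‖ψ x‖ₑ ∂μ < ∞ := by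
        rw [h1]
        exact ENNReal.mul_lt_top ENNReal.coe_lt_top (h2.trans_lt (ENNReal.mul_lt_top (ENNReal.mul_lt_top ENNReal.ofReal_lt_top hfin𝓕) hSfin))
      exact lt_top_iff_ne_top.2 fun htop => (lt_top_iff_ne_top.1 h3) (by rw [htop, ENNReal.mul_top (by exact_mod_cast hpos.2.ne')])
    -- orthogonality (on the square-integrable class) + the adjunction for `conj ψ`
    have h0 := horth Φ hΦm hΦN h2Φ
    have hfin' : ∫⁻ x, (∑' q : Γ ⧸ N.subgroupOf Γ, ‖Φ (x.out * (q.out : G))‖ₑ) * ‖conj (ψ x)‖ₑ ∂μ < ∞ := by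
      refine lt_of_le_of_lt (le_of_eq (lintegral_congr fun x => ?_)) hfinΦ
      rw [← ofReal_norm (conj (ψ x)), Complex.norm_conj, ofReal_norm]
    obtain ⟨-, hadj⟩ := integrable_and_integral_pseudoEisenstein_mul_eq Γ N μ μN ν νN hΦm hΦN hψc'.measurable h𝓕 hμ hfin'
    rw [h0, mul_zero] at hadj
    have hc : ((unfoldingConstant Γ count μ ν : ℝ) : ℂ) ≠ 0 := by
      exact_mod_cast (unfoldingConstant_pos_of_ne_zero Γ N μ μN ν νN hμ hμN0).1.ne'
    have h4 : ∫ y, Φ y.out * ∫ u in 𝓕, conj (ψ (QuotientGroup.mk (y.out * (u : G)⁻¹))) ∂νN ∂μN = 0 :=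
      (mul_eq_zero.1 hadj.symm).resolve_left hc
    rw [← h4, ← integral_indicator hS]
    refine integral_congr_ae (Eventually.of_forall fun y => ?_)
    change S.indicator hb y = Φ y.out * ∫ u in 𝓕, conj (ψ (QuotientGroup.mk (y.out * (u : G)⁻¹))) ∂νN
    rw [hΦ, QuotientGroup.out_eq', ← hh, ← hhb]
    by_cases hy : y ∈ S
    · rw [Set.indicator_of_mem hy, Set.indicator_of_mem hy, one_mul]
    · rw [Set.indicator_of_notMem hy, Set.indicator_of_notMem hy, zero_mul]
  -- `hb = 0` a.e. on `π_N(K₀)`, hence at every point (continuity, `μ_N` charges open sets)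
  intro y₀
  by_contra hy₀
  obtain ⟨K₀, hK₀, hK₀g⟩ := exists_compact_mem_nhds (y₀.out : G)
  obtain ⟨M, hM0, hMb, -⟩ := hbound hK₀
  have hKm : MeasurableSet (QuotientGroup.mk '' K₀ : Set (G ⧸ N)) := (hK₀.image QuotientGroup.continuous_mk).isClosed.measurableSet
  have hKfin : μN (QuotientGroup.mk '' K₀) < ∞ := (hK₀.image QuotientGroup.continuous_mk).measure_lt_top
  have hint : Integrable hb (μN.restrict (QuotientGroup.mk '' K₀)) :=
    Measure.integrableOn_of_bounded hKfin.ne hbm.aestronglyMeasurable (M := M * (νN 𝓕).toReal)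
      ((ae_restrict_iff' hKm).2 (Eventually.of_forall fun y hy => hMb y hy))
  have hae : hb =ᵐ[μN.restrict (QuotientGroup.mk '' K₀)] 0 := by
    refine hint.ae_eq_zero_of_forall_setIntegral_eq_zero fun s hs _ => ?_
    rw [Measure.restrict_restrict hs]
    exact hvanish hK₀ (s ∩ QuotientGroup.mk '' K₀) (hs.inter hKm) Set.inter_subset_right
  -- the open set where `hb ≠ 0` inside `π_N(interior K₀)` contains `y₀` and has measure zero: contradiction
  set V : Set (G ⧸ N) := QuotientGroup.mk '' interior K₀ ∩ {y | hb y ≠ 0} with hV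
  have hVopen : IsOpen V := (QuotientGroup.isOpenMap_coe _ isOpen_interior).inter (isOpen_ne_fun hbc continuous_const)
  have hy₀V : y₀ ∈ V := by
    refine ⟨⟨y₀.out, mem_interior_iff_mem_nhds.2 hK₀g, QuotientGroup.out_eq' y₀⟩, hy₀⟩
  have hVpos : 0 < μN V := hVopen.measure_pos μN ⟨y₀, hy₀V⟩
  have h0 : μN ({y | hb y ≠ 0} ∩ QuotientGroup.mk '' K₀) = 0 := by
    rw [← Measure.restrict_apply' hKm]
    have h1 := ae_iff.1 hae
    simpa using h1
  have hsubV : V ⊆ {y | hb y ≠ 0} ∩ QuotientGroup.mk '' K₀ := fun y hy => ⟨hy.2, Set.image_mono interior_subset hy.1⟩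
  have hVzero : μN V = 0 := measure_mono_null hsubV h0
  exact hVpos.ne' hVzero

end Criterion

/-! ## §2 Adelic reading: the hypothesis `hF3` of ★ (H2)-d at the radical `N_i`, PROVED -/

section Adelic

variable {K : Type} [Field K] [NumberField K] (𝒢 : AdelicGroupData K)
  [MeasurableSpace 𝒢.Adelic] [BorelSpace 𝒢.Adelic] [LocallyCompactSpace 𝒢.Adelic] [SecondCountableTopology 𝒢.Adelic] [T2Space 𝒢.Adelic]
  [DiscreteTopology 𝒢.quotientSubgroup] (hQ : 𝒢.quotientSubgroup = 𝒢.arithmeticSubgroup)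
  (𝔓 : 𝒢.ParabolicUnipotentData) (i : 𝔓.ι) [hN : IsClosed ((𝔓.radical i : Subgroup 𝒢.Adelic) : Set 𝒢.Adelic)]
  (μ : Measure 𝒢.automorphicQuotient) [𝒢.IsAutomorphicMeasure μ]
  [MeasurableSpace (𝒢.Adelic ⧸ 𝔓.radical i)] [BorelSpace (𝒢.Adelic ⧸ 𝔓.radical i)]
  (μN : Measure (𝒢.Adelic ⧸ 𝔓.radical i)) [SMulInvariantMeasure 𝒢.Adelic (𝒢.Adelic ⧸ 𝔓.radical i) μN] [IsFiniteMeasureOnCompacts μN] [μN.IsOpenPosMeasure]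
  (νN : Measure (𝔓.radical i)) [IsHaarMeasure νN] [νN.IsInvInvariant]

include hQ μN νN in
/-- **THE CUSPIDALITY CRITERION ALONG `N_i` ON `X = G(𝔸) ⧸ G(K)`, SQUARE-INTEGRABLE TEST CLASS** — the hypothesis `hF3` of ★ (H2)-d
`orthogonal_span_pseudoEisenstein_le_cuspidalSubspace` at the radical `N_i`, PROVED: for CONTINUOUS `ψ : X → ℂ` with `∫_X θ_Φ · conj ψ dμ = 0` for every Borel
right-`N_i(𝔸)`-invariant `Φ` with `∫⁻_X θ_{‖Φ‖}² dμ < ∞` (given `A_G = 1`, `N_i(K)` co-compact in `N_i(𝔸)`, an inversion-invariant Haar `ν_N` on `N_i(𝔸)`, an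
invariant `μ_N` on `G(𝔸)⧸N_i(𝔸)` positive on open sets): ALL constant terms of `ψ` along `N_i` vanish (★ F3b's transfer to every Borel structure, Haar measure and
fundamental domain, over §1). [cite: MoeglinWaldspurger1995, II.1.3] [cite: BorelJacquet1979, §4.4] -/
theorem constantTermVanishes_of_forall_pseudoEisenstein_sq (hcpt : ∃ C : Set (𝔓.radical i), IsCompact C ∧ ∀ u : 𝔓.radical i, ∃ l : 𝔓.rational i, l • u ∈ C)
    {ψ : 𝒢.automorphicQuotient → ℂ} (hψ : Continuous ψ)
    (horth : ∀ Φ : 𝒢.Adelic → ℂ, Measurable Φ → (∀ (g : 𝒢.Adelic) (n : 𝔓.radical i), Φ (g * n) = Φ g) →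
      ∫⁻ x, (∑' q : 𝒢.quotientSubgroup ⧸ (𝔓.radical i).subgroupOf 𝒢.quotientSubgroup,
          ‖Φ ((Quotient.out x : 𝒢.Adelic) * ((q.out : 𝒢.quotientSubgroup) : 𝒢.Adelic))‖ₑ) ^ 2 ∂μ < ∞ →
        ∫ x, (∑' q : 𝒢.quotientSubgroup ⧸ (𝔓.radical i).subgroupOf 𝒢.quotientSubgroup,
          Φ ((Quotient.out x : 𝒢.Adelic) * ((q.out : 𝒢.quotientSubgroup) : 𝒢.Adelic))) * conj (ψ x) ∂μ = 0) :
    AdelicGroupData.ConstantTermVanishes 𝔓 ψ i := by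
  intro mN hB ν hν 𝓕 h𝓕 x
  -- any Borel structure on `N_i(𝔸)` is the subtype one
  have hmN : mN = (Subtype.instMeasurableSpace : MeasurableSpace (𝔓.radical i)) :=
    hB.measurable_eq.trans (@BorelSpace.measurable_eq _ _ Subtype.instMeasurableSpace
      (Subtype.borelSpace ((𝔓.radical i : Subgroup 𝒢.Adelic) : Set 𝒢.Adelic))).symm
  subst hmN
  -- the house instances on the automorphic quotient and the closed subgroup `N_i(𝔸)`
  letI := AdelicGroupData.measurableSpaceQuotientForm 𝒢
  haveI := AdelicGroupData.borelSpaceQuotientForm 𝒢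
  haveI := AdelicGroupData.smulInvariantMeasureQuotientForm 𝒢 μ
  haveI := AdelicGroupData.isFiniteMeasureOnCompactsQuotientForm 𝒢 μ
  haveI : @IsFiniteMeasure (𝒢.Adelic ⧸ 𝒢.quotientSubgroup) _ μ := ⟨measure_lt_top μ _⟩
  haveI : LocallyCompactSpace (𝔓.radical i) := hN.isClosedEmbedding_subtypeVal.locallyCompactSpace
  haveI : SecondCountableTopology (𝔓.radical i) := TopologicalSpace.Subtype.secondCountableTopology _
  haveI : SigmaFinite νN := by infer_instance
  -- co-compactness and the fundamental domain in the `Γ ∩ N` currency of ★ F3a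
  obtain ⟨C, hC, hcov⟩ := hcpt
  have hcov' : ∀ u : 𝔓.radical i, ∃ δ : (𝒢.quotientSubgroup).subgroupOf (𝔓.radical i), δ • u ∈ C := fun u => by
    obtain ⟨l, hl⟩ := hcov u
    exact ⟨⟨(l : 𝔓.radical i), by rw [← rational_eq_subgroupOf 𝒢 hQ 𝔓 i]; exact l.2⟩, hl⟩
  -- `ν = c • ν_N`, `c ≠ 0`
  have hνeq : ν = haarScalarFactor ν νN • νN := isMulLeftInvariant_eq_smul ν νN
  have hc0 : haarScalarFactor ν νN ≠ 0 := (haarScalarFactor_pos_of_isHaarMeasure ν νN).ne'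
  have hac : νN ≪ ν := by
    refine Measure.AbsolutelyContinuous.mk fun s _ hs => ?_
    rw [hνeq, Measure.smul_apply, ENNReal.smul_def, smul_eq_mul, mul_eq_zero] at hs
    exact hs.resolve_left (ENNReal.coe_ne_zero.2 hc0)
  have h𝓕' : IsFundamentalDomain ((𝒢.quotientSubgroup).subgroupOf (𝔓.radical i)) 𝓕 νN := by
    rw [← rational_eq_subgroupOf 𝒢 hQ 𝔓 i]
    exact h𝓕.mono hac
  -- §1 for `ν_N`
  have hint := integrableOn_constantTerm 𝒢.quotientSubgroup (𝔓.radical i) νN (ψ := ψ) hψ hC hcov' h𝓕' x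
  have hzero := setIntegral_constantTerm_eq_zero_of_forall_sq 𝒢.quotientSubgroup (𝔓.radical i) μ μN haar νN
    (AdelicGroupData.IsAutomorphicMeasure.ne_zero 𝒢 μ) hψ hC hcov' horth h𝓕' x
  -- transfer to `ν = c • ν_N`
  refine ⟨?_, ?_⟩
  · rw [IntegrableOn, hνeq, Measure.restrict_smul]
    exact hint.smul_measure ENNReal.coe_ne_top
  · rw [hνeq, Measure.restrict_smul, integral_smul_nnreal_measure]
    change haarScalarFactor ν νN • ∫ u in 𝓕, ψ (QuotientGroup.mk (x * (u : 𝒢.Adelic)⁻¹)) ∂νN = 0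
    rw [hzero, smul_zero]

end Adelic

/-! ## §3 (H2)-f ASSEMBLY: `(span Θ)ᗮ ≤ L²_cusp` and `(L²_cusp)ᗮ = closure (span Θ)`, unconditionally on the radical data -/

section Assembly

variable {K : Type} [Field K] [NumberField K] (𝒢 : AdelicGroupData K)
  [MeasurableSpace 𝒢.Adelic] [BorelSpace 𝒢.Adelic] [LocallyCompactSpace 𝒢.Adelic] [SecondCountableTopology 𝒢.Adelic] [T2Space 𝒢.Adelic]
  [DiscreteTopology 𝒢.quotientSubgroup] (hQ : 𝒢.quotientSubgroup = 𝒢.arithmeticSubgroup)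
  (𝔓 : 𝒢.ParabolicUnipotentData) [hN : ∀ i : 𝔓.ι, IsClosed ((𝔓.radical i : Subgroup 𝒢.Adelic) : Set 𝒢.Adelic)]
  (μ : Measure 𝒢.automorphicQuotient) [𝒢.IsAutomorphicMeasure μ]
  [∀ i : 𝔓.ι, MeasurableSpace (𝒢.Adelic ⧸ 𝔓.radical i)] [∀ i : 𝔓.ι, BorelSpace (𝒢.Adelic ⧸ 𝔓.radical i)]
  (μN : ∀ i : 𝔓.ι, Measure (𝒢.Adelic ⧸ 𝔓.radical i)) [∀ i : 𝔓.ι, SMulInvariantMeasure 𝒢.Adelic (𝒢.Adelic ⧸ 𝔓.radical i) (μN i)]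
  [∀ i : 𝔓.ι, IsFiniteMeasureOnCompacts (μN i)] [∀ i : 𝔓.ι, (μN i).IsOpenPosMeasure]
  (νN : ∀ i : 𝔓.ι, Measure (𝔓.radical i)) [∀ i : 𝔓.ι, IsHaarMeasure (νN i)] [∀ i : 𝔓.ι, SFinite (νN i)] [∀ i : 𝔓.ι, (νN i).IsInvInvariant]

omit [∀ i : 𝔓.ι, SFinite (νN i)] in
include hQ μN νN in
/-- **`(span Θ)ᗮ ≤ L²_cusp` UNCONDITIONALLY ON THE RADICAL DATA**: a vector of `L²(X, μ)` orthogonal to every square-integrable pseudo-Eisenstein series `[θ_Φ]`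
(`Φ ∈ 𝒯_i`, all radicals `N_i`) is cuspidal — ★ (H2)-d `orthogonal_span_pseudoEisenstein_le_cuspidalSubspace` with its hypothesis `hF3` discharged by §2, given at
every radical: `N_i(𝔸)` closed, `N_i(K)` co-compact, an invariant `μ_N` finite on compacts and positive on opens, an inversion-invariant Haar `ν_N`, and `A_G = 1`.
[cite: MoeglinWaldspurger1995, II.1.2–II.1.4] [cite: Garrett2018, §1.8] -/
theorem orthogonal_span_pseudoEisenstein_le_cuspidalSubspace_of_cocompact
    (hcpt : ∀ i : 𝔓.ι, ∃ C : Set (𝔓.radical i), IsCompact C ∧ ∀ u : 𝔓.radical i, ∃ l : 𝔓.rational i, l • u ∈ C) :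
    (Submodule.span ℂ {f : 𝒢.L2 μ | ∃ (i : 𝔓.ι) (Φ : 𝒢.Adelic → ℂ) (hΦm : Measurable Φ)
        (hΦ : ∀ (g : 𝒢.Adelic) (n : 𝔓.radical i), Φ (g * n) = Φ g)
        (h2 : ∫⁻ x, (∑' q : 𝒢.quotientSubgroup ⧸ (𝔓.radical i).subgroupOf 𝒢.quotientSubgroup,
          ‖Φ ((Quotient.out x : 𝒢.Adelic) * ((q.out : 𝒢.quotientSubgroup) : 𝒢.Adelic))‖ₑ) ^ 2 ∂μ < ∞),
        f = (memLp_two_pseudoEisenstein_automorphicQuotient 𝒢 𝔓 i μ hΦm hΦ h2).toLp _})ᗮ ≤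
      (𝒢.cuspidalSubspace μ 𝔓).toSubmodule :=
  orthogonal_span_pseudoEisenstein_le_cuspidalSubspace 𝒢 𝔓 μ fun i _ hψ _ horth =>
    constantTermVanishes_of_forall_pseudoEisenstein_sq 𝒢 hQ 𝔓 i μ (μN i) (νN i) (hcpt i) hψ horth

omit [∀ i : 𝔓.ι, SFinite (νN i)] in
include hQ μN νN in
/-- **PREDICATE FORM, UNCONDITIONAL ON THE RADICAL DATA**: `v ∈ L²(X, μ)` with `⟪[θ_Φ], v⟫ = 0` for every radical `N_i` and every `Φ ∈ 𝒯_i` is CUSPIDAL.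
[cite: MoeglinWaldspurger1995, II.1.2–II.1.4] [cite: Garrett2018, §1.8] -/
theorem mem_cuspidalSubspace_of_forall_inner_pseudoEisenstein_eq_zero_of_cocompact
    (hcpt : ∀ i : 𝔓.ι, ∃ C : Set (𝔓.radical i), IsCompact C ∧ ∀ u : 𝔓.radical i, ∃ l : 𝔓.rational i, l • u ∈ C) {v : 𝒢.L2 μ}
    (hv : ∀ (i : 𝔓.ι) (Φ : 𝒢.Adelic → ℂ) (hΦm : Measurable Φ) (hΦ : ∀ (g : 𝒢.Adelic) (n : 𝔓.radical i), Φ (g * n) = Φ g)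
      (h2 : ∫⁻ x, (∑' q : 𝒢.quotientSubgroup ⧸ (𝔓.radical i).subgroupOf 𝒢.quotientSubgroup,
        ‖Φ ((Quotient.out x : 𝒢.Adelic) * ((q.out : 𝒢.quotientSubgroup) : 𝒢.Adelic))‖ₑ) ^ 2 ∂μ < ∞),
      ⟪(memLp_two_pseudoEisenstein_automorphicQuotient 𝒢 𝔓 i μ hΦm hΦ h2).toLp _, v⟫_ℂ = 0) :
    v ∈ 𝒢.cuspidalSubspace μ 𝔓 :=
  mem_cuspidalSubspace_of_forall_inner_pseudoEisenstein_eq_zero 𝒢 𝔓 μ (fun i _ hψ _ horth =>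
    constantTermVanishes_of_forall_pseudoEisenstein_sq 𝒢 hQ 𝔓 i μ (μN i) (νN i) (hcpt i) hψ horth) hv

include hQ μN νN in
/-- **`(L²_cusp)ᗮ = closure (span Θ)` UNCONDITIONALLY ON THE RADICAL DATA: THE SQUARE-INTEGRABLE PSEUDO-EISENSTEIN SERIES ARE DENSE IN THE ORTHOGONAL COMPLEMENT OF THE
CUSPIDAL SUBSPACE.**  Hypotheses, at every radical `N_i`: `N_i(𝔸)` closed, `N_i(K)` co-compact in `N_i(𝔸)`, an invariant measure `μ_N` on `G(𝔸) ⧸ N_i(𝔸)` finite on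
compacts and positive on opens, an inversion-invariant s-finite Haar `ν_N` on `N_i(𝔸)` with a measurable fundamental domain for `N_i(K)`; and `A_G = 1`, `A_G G(K)`
discrete, `μ` automorphic.  (★ (H2)-d `cuspidalSubspace_orthogonal_eq_topologicalClosure_span` with `hF3` discharged by §2; `⊇` is ★ F2b.)
[cite: MoeglinWaldspurger1995, II.1.2–II.1.4] [cite: Garrett2018, §1.8] [cite: BorelJacquet1979, §4.6] -/
theorem cuspidalSubspace_orthogonal_eq_topologicalClosure_span_of_cocompact
    (hcpt : ∀ i : 𝔓.ι, ∃ C : Set (𝔓.radical i), IsCompact C ∧ ∀ u : 𝔓.radical i, ∃ l : 𝔓.rational i, l • u ∈ C)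
    {𝓕 : ∀ i : 𝔓.ι, Set (𝔓.radical i)} (h𝓕 : ∀ i, IsFundamentalDomain (𝔓.rational i) (𝓕 i) (νN i)) :
    (𝒢.cuspidalSubspace μ 𝔓).toSubmoduleᗮ =
      (Submodule.span ℂ {f : 𝒢.L2 μ | ∃ (i : 𝔓.ι) (Φ : 𝒢.Adelic → ℂ) (hΦm : Measurable Φ)
        (hΦ : ∀ (g : 𝒢.Adelic) (n : 𝔓.radical i), Φ (g * n) = Φ g)
        (h2 : ∫⁻ x, (∑' q : 𝒢.quotientSubgroup ⧸ (𝔓.radical i).subgroupOf 𝒢.quotientSubgroup,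
          ‖Φ ((Quotient.out x : 𝒢.Adelic) * ((q.out : 𝒢.quotientSubgroup) : 𝒢.Adelic))‖ₑ) ^ 2 ∂μ < ∞),
        f = (memLp_two_pseudoEisenstein_automorphicQuotient 𝒢 𝔓 i μ hΦm hΦ h2).toLp _}).topologicalClosure := by
  have hμN : ∀ i, μN i ≠ 0 := fun i h0 => by
    have hpos := isOpen_univ.measure_pos (μN i) ⟨(QuotientGroup.mk 1 : 𝒢.Adelic ⧸ 𝔓.radical i), trivial⟩
    rw [h0] at hpos
    exact lt_irrefl _ hpos
  exact cuspidalSubspace_orthogonal_eq_topologicalClosure_span 𝒢 𝔓 μ hQ μN νN h𝓕 hμN fun i _ hψ _ horth =>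
    constantTermVanishes_of_forall_pseudoEisenstein_sq 𝒢 hQ 𝔓 i μ (μN i) (νN i) (hcpt i) hψ horth

end Assembly

end Summit.HodgeConjecture.HodgeConjecture.Cruxes.H413.K2E1PseudoEisensteinCuspidalCriterionL2

end
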